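import Literature.NumberTheory.EllipticCurves.QuadraticTwistFramedTorsion
import Literature.NumberTheory.EllipticCurves.SelmerCorankProofs
import Literature.NumberTheory.EllipticCurves.GaloisActionProofs
import Literature.NumberTheory.EllipticCurves.SquareClassHeightRat
import Literature.NumberTheory.EllipticCurves.MazurTorsion
import HarnessLib

/-!
# Only finitely many quadratic twists have a rational point of odd prime-to-`2` order `p`
# (Mazur–Rubin, Invent. Math. 181 (2010), Lemma 5.5, fixed odd `p`), PROVED

`Proofs` file (theorems only; no definition, no named fact — D-0014/D-0026) in topic
`Literature/NumberTheory/EllipticCurves`, written by the cross-ladder literature-typing layer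
(cell `bsd-littype`, seat 08; honest framing of the cell: "typed ≠ proved ≠ endorsed", nothing here
bears on BSD beyond bookkeeping in twist families).

Source, VERBATIM (B. Mazur, K. Rubin, *Ranks of twists of elliptic curves and Hilbert's tenth
problem*, Invent. Math. 181 (2010) 541–575 = held author manuscript
`paper:anon2010-ranks-twists-elliptic-curves-hilberts-tenth-problem`, §5, p0017 L67–68 and proof
p0018 L3–13): "**Lemma 5.5.** Suppose `E` is an elliptic curve over `K`. Then for all but finitely
many quadratic twists `E′` of `E`, `E′(K)` has no odd-order torsion. *Proof.* This is proved in
[GM, Proposition 1] when `K = ℚ`; we adapt the proof given there. By Merel's Uniform Boundedness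
Theorem […] the set `{primes p : E^F(K)[p] ≠ 0 for some quadratic extension F/K}` is finite. On
the other hand, if `p` is odd and `ρ_p : G_K → Aut(E[p]) ≅ GL₂(𝔽_p)` denotes the mod-`p`
representation attached to `E`, then there are at most two characters `χ` of `G_K` such that
`ρ_p ⊗ χ` contains a copy of the trivial representation. Therefore for fixed odd `p`, the set
`{F/K quadratic : E^F(K)[p] ≠ 0}` has order at most `2`. This completes the proof."
(`[GM]` = Gouvêa–Mazur, J. Amer. Math. Soc. 4 (1991), Prop. 1.)

## What is proved here (the FIXED-`p` clause, in the tree's square-class vocabulary)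

For an elliptic curve `W` over a number field `K`, an ODD natural number `p` (the printed "`p`
odd"; primality is not needed for finiteness) and the quadratic twists `W^{(s)} = W.quadraticTwist s`
(`s ∈ K^×`; the `K`-isomorphism class of `W^{(s)}` only depends on the square class
`[s] ∈ K^×/(K^×)²` = `SquareClass K`):

* `finite_setOf_twistClass_exists_torsion_ne_zero` — **the set of square classes `t` such that some
  twist `W^{(s)}`, `[s] = t`, has a NON-ZERO `K`-rational point killed by `p` is finite**;
* `finite_setOf_twistClass_natCard_torsionBy_ne_one` — the same with "`#W^{(s)}(K)[p] ≠ 1`";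
* `natCard_torsionBy_quadraticTwist_eq_one_of_not_mem` — off that finite set, `#W^{(s)}(K)[p] = 1`
  for EVERY representative `s` of the class;
* `ncard_setOf_twistClass_exists_torsion_ne_zero_le_two` — **the printed bound**: for an odd PRIME
  `p`, at most TWO such square classes (§6);
* `natCard_two_torsionBy_quadraticTwist_eq_one` — at `p = 2` (where the printed lemma is silent:
  "`p` odd") the rational `2`-torsion is COMMON to the family: `W(K)[2] = 0 ⟹ W^{(s)}(K)[2] = 0`
  for every `s` (§7);
* `finite_setOf_twistClass_exists_odd_torsion_rat` — over `K = ℚ`, the printed UNIFORM statement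
  ("for all but finitely many quadratic twists `E′` of `E`, `E′(ℚ)` has no odd-order torsion")
  modulo Mazur's torsion theorem as the tree's named fact `Mazur1977_addOrderOf_le` (binder `hMz`,
  every curve over `ℚ`): odd torsion orders are `≤ 10`, so only `p ∈ {3, 5, 7}` occur.

The printed bound "at most `2`" (two characters) is PROVED in §6 for an odd PRIME `p`
(`ncard_setOf_twistClass_exists_torsion_ne_zero_le_two`: three exceptional classes would give three
eigen-lines for three distinct quadratic characters inside `E[p](K̄) ≅ (ℤ/p)²`); §4 gives finiteness
for every odd `p` by injecting the exceptional classes into the finite group `E[p](K̄)`; the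
uniform-in-`p` statement is proved over `ℚ` only (§5: Mazur's theorem in place of Merel's, which the
tree does not have).

## Proof (the printed one, with "`ρ_p ⊗ χ` contains the trivial representation" unfolded)

1. (`exists_geomPoint_sign_of_torsion_quadraticTwist`) A non-zero `Q ∈ W^{(s)}(K)` with `p Q = 0`
   gives, through the equivariant-up-to-sign isomorphism `f : W^{(s)}(K̄) ≃+ W(K̄)` of Silverman
   *AEC* X.5 Cor. 5.4 (tree THEOREM `WeierstrassCurve.exists_addEquiv_geomPoints_quadraticTwist_sqrt`:
   `f(σP) = χ_s(σ) σ f(P)` with `χ_s(σ) = σ√s/√s`), a point `P = f(Q) ∈ E[p](K̄) ∖ {0}` with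
   `σP = χ_s(σ) P` for all `σ ∈ Γ_K` — i.e. "`ρ_p ⊗ χ_s` contains the trivial representation".
2. (`squareClassOf_eq_of_sign`) Such a `P` determines the class `[s]`: since `p` is odd, `P ≠ -P`
   (`ne_neg_of_odd_nsmul_eq_zero`), so `χ_s(σ) = χ_{s'}(σ)` is read off `σP`; then `√s √s'` is
   `Γ_K`-fixed, hence in `K` (Galois descent in `K̄`, `exists_algebraMap_eq_of_forall_smul_eq_algClosure`),
   so `s s'` is a square and `[s] = [s']` (`squareClassOf_eq_of_forall_smul_geomSqrt_iff`).
3. Hence `t ↦ P` is an injection of the exceptional classes into the finite set `E[p](K̄)`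
   (`finite_torsionPoints_holds`, Silverman *AEC* III.6.4).

Consumers: the Cassels–Tate parity bridge in twist families
(`TwistFamilySelmerCorankParityProofs.lean`: "`dim_{𝔽_p} Sel_p(E^{(s)}) = 1 ⟹ corank_{ℤ_p}
Sel_{p^∞}(E^{(s)}) = 1` off the finitely many classes with `E^{(s)}(K)[p] ≠ 0`"), e.g. for the
BKLOS `19a3` proportions (`GoldfeldProportionsCremona19a3.lean`, module docstring: "the parity
bridge … off the finitely many classes with rational `3`-torsion … neither in the tree").

## References

* [MazurRubin2010] B. Mazur, K. Rubin, Invent. Math. 181 (2010) 541–575, Lemma 5.5 and its proof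
  (§5; held manuscript p0017 L67–68, p0018 L3–13).
* [Mazur1977] B. Mazur, Publ. Math. IHÉS 47 (1977), Thm. (7') p. 35 / Thm. (8) (tree facts
  `Mazur1977_addOrderOf_le`, `mazur_torsion`).
* [SilvermanAEC2009] J. H. Silverman, *The Arithmetic of Elliptic Curves*, 2nd ed., X.5 Cor. 5.4
  (the twist isomorphism over `K(√d)`), III.6.4 (finiteness of `E[m]`), VIII.§1 (`E(K) ↪ E(K̄)`).
* [BhargavaKlagsbrunLemkeOliverShnidman2019] Duke Math. J. 168 (2019), §2 (square classes
  `s ∈ F^*/F^{*2}`, the twists `E_s`).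
-/

noncomputable section

open scoped Classical
open Field WeierstrassCurve

universe u

namespace Literature.NumberTheory.EllipticCurves

/-! ## §1 Galois descent in `K̄` and square classes read off the quadratic character -/

section Descent

variable {K : Type u} [Field K] [CharZero K]

/-- **Galois descent in `K̄`** (characteristic `0`): an element of `K̄` fixed by every
`σ ∈ Γ_K = Gal(K̄/K)` lies in `K`. (Mathlib's `InfiniteGalois.mem_range_algebraMap_iff_fixed` for
the Galois extension `K̄/K`, `IsAlgClosure.isGalois`.) The step "`√s√s'` is `G_K`-invariant, hence
in `K`" of the printed proof. [cite: MazurRubin2010, Lemma 5.5 (proof, §5)] -/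
theorem exists_algebraMap_eq_of_forall_smul_eq_algClosure {x : AlgebraicClosure K}
    (hx : ∀ σ : absoluteGaloisGroup K, σ • x = x) :
    ∃ c : K, algebraMap K (AlgebraicClosure K) c = x :=
  (InfiniteGalois.mem_range_algebraMap_iff_fixed x).mpr fun σ ↦ hx σ

/-- **Two quadratic characters with the same kernel give the same square class**: for
`c, d ∈ K^×`, if `σ√c = √c ⟺ σ√d = √d` for every `σ ∈ Γ_K` (i.e. `χ_c = χ_d`), then `[c] = [d]` in
`K^×/(K^×)²`. Indeed `√c√d` is then `Γ_K`-fixed (`σ` moves both or neither, `smul_geomSqrt_eq_or`),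
so `√c√d = u ∈ K`, `u² = cd`, `d = c (u/c)²`. The printed "at most two characters `χ`" step reads
the twist off its character. [cite: MazurRubin2010, Lemma 5.5 (proof, §5: the characters χ of G_K)] -/
theorem squareClassOf_eq_of_forall_smul_geomSqrt_iff {c d : K} (hc : c ≠ 0) (hd : d ≠ 0)
    (h : ∀ σ : absoluteGaloisGroup K, σ • geomSqrt c = geomSqrt c ↔ σ • geomSqrt d = geomSqrt d) :
    squareClassOf c = squareClassOf d := by
  -- `√c √d` is `Γ_K`-fixed
  have hfix : ∀ σ : absoluteGaloisGroup K,
      σ • (geomSqrt c * geomSqrt d) = geomSqrt c * geomSqrt d := by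
    intro σ
    rw [smul_mul']
    rcases smul_geomSqrt_eq_or σ c with hσc | hσc
    · rw [hσc, (h σ).1 hσc]
    · have hσd : σ • geomSqrt d = -geomSqrt d := by
        rcases smul_geomSqrt_eq_or σ d with hσd | hσd
        · exact absurd ((h σ).2 hσd) (by rw [hσc]; exact fun e ↦ geomSqrt_ne_neg hc e.symm)
        · exact hσd
      rw [hσc, hσd, neg_mul_neg]
  obtain ⟨u, hu⟩ := exists_algebraMap_eq_of_forall_smul_eq_algClosure hfix
  -- `u² = c d`
  have hu2 : u ^ 2 = c * d := by
    apply (algebraMap K (AlgebraicClosure K)).injective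
    rw [map_pow, hu, mul_pow, geomSqrt_sq, geomSqrt_sq, map_mul]
  have hu0 : u ≠ 0 := by
    intro h0
    rw [h0, zero_pow two_ne_zero, eq_comm] at hu2
    exact mul_ne_zero hc hd hu2
  -- `d = c (u/c)²`
  have hdc : d = c * (u / c) ^ 2 := by
    field_simp
    rw [hu2]
    ring
  rw [hdc, squareClassOf_mul_sq hc (div_ne_zero hu0 hc)]

end Descent

/-! ## §2 A non-zero point of odd order is not its own negative -/

/-- If `p` is odd, `p • P = 0` and `P ≠ 0` then `P ≠ -P` (otherwise `2P = 0`, and `gcd(2, p) = 1`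
forces `P = 0`). The reason the printed argument needs "`p` odd".
[cite: MazurRubin2010, Lemma 5.5 (proof, §5: "if p is odd")] -/
theorem ne_neg_of_odd_nsmul_eq_zero {A : Type*} [AddCommGroup A] {p : ℕ} (hp : Odd p) {P : A}
    (hpP : p • P = 0) (hP : P ≠ 0) : P ≠ -P := by
  intro h
  have h2 : 2 • P = 0 := by
    rw [two_nsmul]
    nth_rewrite 2 [h]
    exact add_neg_cancel P
  obtain ⟨k, rfl⟩ := hp
  apply hP
  have : (2 * k + 1) • P = P := by
    rw [add_nsmul, one_nsmul, mul_nsmul, h2, nsmul_zero, zero_add]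
  rw [← this, hpP]

/-! ## §3 The twisted point in `E[p](K̄)` attached to a rational torsion point of a twist -/

section Twist

variable {K : Type u} [Field K] [NumberField K]

/-- **A rational `p`-torsion point of the twist `W^{(s)}` is a `χ_s`-eigenvector in `E[p](K̄)`**
(step 1 of the printed proof: "`ρ_p ⊗ χ` contains a copy of the trivial representation"): for
`s ≠ 0` and `Q ∈ W^{(s)}(K)`, `Q ≠ 0`, `n Q = 0`, there is `P ∈ W(K̄)`, `P ≠ 0`, `n P = 0`, with
`σP = P` whenever `σ√s = √s` and `σP = -P` whenever `σ√s = -√s` (`σ ∈ Γ_K`). `P = f(Q)` for the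
isomorphism `f : W^{(s)}(K̄) ≃+ W(K̄)` of Silverman *AEC* X.5 Cor. 5.4, equivariant up to the sign
`σ√s/√s` (tree theorem `WeierstrassCurve.exists_addEquiv_geomPoints_quadraticTwist_sqrt`), `Q`
being `Γ_K`-fixed in `W^{(s)}(K̄)` (`smul_toGeomPoints`).
[cite: MazurRubin2010, Lemma 5.5 (proof, §5)] [cite: SilvermanAEC2009, X.5 Cor. 5.4] -/
theorem exists_geomPoint_sign_of_torsion_quadraticTwist (W : WeierstrassCurve K) {s : K}
    (hs : s ≠ 0) {n : ℕ} {Q : (W.quadraticTwist s).toAffine.Point} (hnQ : n • Q = 0)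
    (hQ0 : Q ≠ 0) :
    ∃ P : W.geomPoints, P ≠ 0 ∧ n • P = 0 ∧
      ∀ σ : absoluteGaloisGroup K,
        (σ • geomSqrt s = geomSqrt s → σ • P = P) ∧
        (σ • geomSqrt s = -geomSqrt s → σ • P = -P) := by
  obtain ⟨f, hf⟩ := W.exists_addEquiv_geomPoints_quadraticTwist_sqrt hs
  set Q' : (W.quadraticTwist s).geomPoints := toGeomPoints (W.quadraticTwist s) Q with hQ'
  have hQ'fix : ∀ σ : absoluteGaloisGroup K, σ • Q' = Q' := fun σ ↦
    smul_toGeomPoints (W.quadraticTwist s) σ Q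
  refine ⟨f Q', ?_, ?_, fun σ ↦ ⟨fun hσ ↦ ?_, fun hσ ↦ ?_⟩⟩
  · intro h0
    apply hQ0
    apply toGeomPoints_injective (W.quadraticTwist s)
    rw [map_zero, ← hQ']
    exact f.injective (by rw [h0, map_zero])
  · rw [← map_nsmul, hQ', ← map_nsmul, hnQ, map_zero, map_zero]
  · rw [← (hf σ).1 hσ Q', hQ'fix]
  · -- `f Q' = f (σQ') = -(σ • f Q')`, i.e. `σ • f Q' = -f Q'`
    have h := (hf σ).2 hσ Q'
    rw [hQ'fix] at h
    exact (neg_eq_iff_eq_neg.mpr h).symm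

/-- **The eigen-point determines the square class** (step 2 of the printed proof, "at most two
characters"): if ONE point `P ∈ W(K̄)`, `P ≠ 0`, `p P = 0` with `p` odd, is a `χ_{s₁}`- and a
`χ_{s₂}`-eigenvector (`σP = ±P` according to `σ√sᵢ = ±√sᵢ`), then `[s₁] = [s₂]`: as `P ≠ -P`
(`ne_neg_of_odd_nsmul_eq_zero`) the two characters agree, and
`squareClassOf_eq_of_forall_smul_geomSqrt_iff` applies. [cite: MazurRubin2010, Lemma 5.5 (proof, §5)] -/
theorem squareClassOf_eq_of_sign (W : WeierstrassCurve K) {p : ℕ} (hp : Odd p) {P : W.geomPoints}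
    (hP0 : P ≠ 0) (hpP : p • P = 0) {s₁ s₂ : K} (hs₁ : s₁ ≠ 0) (hs₂ : s₂ ≠ 0)
    (h₁ : ∀ σ : absoluteGaloisGroup K,
      (σ • geomSqrt s₁ = geomSqrt s₁ → σ • P = P) ∧ (σ • geomSqrt s₁ = -geomSqrt s₁ → σ • P = -P))
    (h₂ : ∀ σ : absoluteGaloisGroup K,
      (σ • geomSqrt s₂ = geomSqrt s₂ → σ • P = P) ∧ (σ • geomSqrt s₂ = -geomSqrt s₂ → σ • P = -P)) :
    squareClassOf s₁ = squareClassOf s₂ := by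
  have hne : P ≠ -P := ne_neg_of_odd_nsmul_eq_zero hp hpP hP0
  refine squareClassOf_eq_of_forall_smul_geomSqrt_iff hs₁ hs₂ fun σ ↦ ⟨fun e₁ ↦ ?_, fun e₂ ↦ ?_⟩
  · rcases smul_geomSqrt_eq_or σ s₂ with e₂ | e₂
    · exact e₂
    · exact absurd (((h₁ σ).1 e₁).symm.trans ((h₂ σ).2 e₂)) hne
  · rcases smul_geomSqrt_eq_or σ s₁ with e₁ | e₁
    · exact e₁
    · exact absurd (((h₂ σ).1 e₂).symm.trans ((h₁ σ).2 e₁)) hne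

/-! ## §4 Mazur–Rubin, Lemma 5.5 (fixed odd `p`): finiteness of the exceptional square classes -/

/-- **Mazur–Rubin 2010, Lemma 5.5, fixed odd `p` (proved): only finitely many quadratic twists
of `E` have a non-zero `K`-rational point killed by `p`.** For an elliptic curve `W` over a number
field `K` and an odd `p : ℕ`, the set of square classes `t ∈ K^×/(K^×)²` such that some twist
`W^{(s)}`, `[s] = t`, has a point `Q ∈ W^{(s)}(K)`, `Q ≠ 0`, `p Q = 0`, is finite. Proof = the
printed one: `t ↦ P ∈ E[p](K̄) ∖ {0}` (`exists_geomPoint_sign_of_torsion_quadraticTwist`) is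
injective (`squareClassOf_eq_of_sign`) into a finite set (`finite_torsionPoints_holds`, Silverman
III.6.4). (The printed bound "at most `2`" for prime `p` is
`ncard_setOf_twistClass_exists_torsion_ne_zero_le_two`, §6.)
[cite: MazurRubin2010, Lemma 5.5 and its proof (§5; manuscript p0017 L67–68, p0018 L3–13)]
[cite: SilvermanAEC2009, Cor. III.6.4 and X.5 Cor. 5.4] -/
theorem finite_setOf_twistClass_exists_torsion_ne_zero (W : WeierstrassCurve K) [W.IsElliptic]
    {p : ℕ} (hp : Odd p) :
    {t : SquareClass K | ∃ s : Kˣ, (QuotientGroup.mk s : SquareClass K) = t ∧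
        ∃ Q : (W.quadraticTwist (s : K)).toAffine.Point, p • Q = 0 ∧ Q ≠ 0}.Finite := by
  set S : Set (SquareClass K) := {t : SquareClass K | ∃ s : Kˣ,
    (QuotientGroup.mk s : SquareClass K) = t ∧
      ∃ Q : (W.quadraticTwist (s : K)).toAffine.Point, p • Q = 0 ∧ Q ≠ 0} with hSdef
  have hp0 : (p : ℤ) ≠ 0 := by
    obtain ⟨k, rfl⟩ := hp
    omega
  haveI : Finite (geomTorsion W (p : ℤ)) := finite_torsionPoints_holds W (AlgebraicClosure K) hp0
  -- the eigen-point of each exceptional class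
  have key : ∀ t ∈ S, ∃ P : geomTorsion W (p : ℤ), ∃ s : Kˣ,
      (QuotientGroup.mk s : SquareClass K) = t ∧ (P : W.geomPoints) ≠ 0 ∧
        ∀ σ : absoluteGaloisGroup K,
          (σ • geomSqrt (s : K) = geomSqrt (s : K) → σ • (P : W.geomPoints) = P) ∧
          (σ • geomSqrt (s : K) = -geomSqrt (s : K) → σ • (P : W.geomPoints) = -P) := by
    rintro t ⟨s, hst, Q, hpQ, hQ0⟩
    obtain ⟨P, hP0, hpP, hP⟩ :=
      exists_geomPoint_sign_of_torsion_quadraticTwist W s.ne_zero hpQ hQ0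
    refine ⟨⟨P, ?_⟩, s, hst, hP0, hP⟩
    exact AddSubgroup.torsionBy.nsmul_iff.mpr hpP
  choose! g hg using key
  have hinj : Set.InjOn g S := by
    intro t₁ ht₁ t₂ ht₂ heq
    obtain ⟨s₁, hs₁t, hP₁0, hP₁⟩ := hg t₁ ht₁
    obtain ⟨s₂, hs₂t, -, hP₂⟩ := hg t₂ ht₂
    rw [heq] at hP₁0 hP₁
    have hpP : p • ((g t₂ : geomTorsion W (p : ℤ)) : W.geomPoints) = 0 :=
      AddSubgroup.torsionBy.nsmul_iff.mp (g t₂).2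
    have h12 := squareClassOf_eq_of_sign W hp hP₁0 hpP s₁.ne_zero s₂.ne_zero hP₁ hP₂
    rw [squareClassOf_units, squareClassOf_units, hs₁t, hs₂t] at h12
    exact h12
  exact Set.Finite.of_finite_image (Set.toFinite _) hinj

/-- **The same finiteness in counting form**: the square classes `t` such that some twist
`W^{(s)}`, `[s] = t`, has `#W^{(s)}(K)[p] ≠ 1` (`p` odd) form a finite set (a non-trivial finite
or infinite torsion subgroup has a non-zero element; `Nat.card_eq_one_iff_unique`).
[cite: MazurRubin2010, Lemma 5.5 and its proof (§5)] -/
theorem finite_setOf_twistClass_natCard_torsionBy_ne_one (W : WeierstrassCurve K) [W.IsElliptic]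
    {p : ℕ} (hp : Odd p) :
    {t : SquareClass K | ∃ s : Kˣ, (QuotientGroup.mk s : SquareClass K) = t ∧
        Nat.card (AddSubgroup.torsionBy (W.quadraticTwist (s : K)).toAffine.Point (p : ℤ)) ≠ 1}.Finite := by
  refine (finite_setOf_twistClass_exists_torsion_ne_zero W hp).subset ?_
  rintro t ⟨s, hst, hcard⟩
  refine ⟨s, hst, ?_⟩
  by_contra hnone
  apply hcard
  rw [Nat.card_eq_one_iff_unique]
  refine ⟨⟨fun x y ↦ ?_⟩, ⟨0⟩⟩
  have hz : ∀ z : AddSubgroup.torsionBy (W.quadraticTwist (s : K)).toAffine.Point (p : ℤ), z = 0 := by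
    intro z
    by_contra hz
    exact hnone ⟨z, AddSubgroup.torsionBy.nsmul_iff.mp z.2, fun h0 ↦ hz (Subtype.ext h0)⟩
  rw [hz x, hz y]

omit [NumberField K] in
/-- **Off the finite exceptional set, every representative twist has trivial rational
`p`-torsion**: if `t` is not in the set of `finite_setOf_twistClass_natCard_torsionBy_ne_one`,
then `#W^{(s)}(K)[p] = 1` for EVERY `s ∈ K^×` with `[s] = t` (unfolding; this is the shape
consumed by `TwistClassSatisfies`, which quantifies over all representatives).
[cite: MazurRubin2010, Lemma 5.5 (§5)] -/
theorem natCard_torsionBy_quadraticTwist_eq_one_of_not_mem (W : WeierstrassCurve K) {p : ℕ}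
    {t : SquareClass K}
    (ht : t ∉ {t : SquareClass K | ∃ s : Kˣ, (QuotientGroup.mk s : SquareClass K) = t ∧
        Nat.card (AddSubgroup.torsionBy (W.quadraticTwist (s : K)).toAffine.Point (p : ℤ)) ≠ 1})
    (s : Kˣ) (hs : (QuotientGroup.mk s : SquareClass K) = t) :
    Nat.card (AddSubgroup.torsionBy (W.quadraticTwist (s : K)).toAffine.Point (p : ℤ)) = 1 := by
  by_contra h
  exact ht ⟨s, hs, h⟩

end Twist

/-! ## §5 Over `ℚ`: the uniform statement (Gouvêa–Mazur Prop. 1 = Mazur–Rubin Lemma 5.5 for `K = ℚ`),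
modulo Mazur's torsion theorem -/

section Rat

/-- **Mazur–Rubin 2010, Lemma 5.5 for `K = ℚ` (= Gouvêa–Mazur, JAMS 4 (1991), Prop. 1), VERBATIM
form: "for all but finitely many quadratic twists `E′` of `E`, `E′(ℚ)` has no odd-order torsion"**
— the set of square classes `t ∈ ℚ^×/(ℚ^×)²` such that some twist `W^{(s)}`, `[s] = t`, has a
rational point of finite ODD order `> 1` is finite. Printed proof: uniform boundedness of torsion
(here, over `ℚ`, MAZUR's theorem — Mazur 1977 Thm. (7'): orders `≤ 10` or `= 12`, the tree's named
fact `Mazur1977_addOrderOf_le`, taken as the hypothesis `hMz` for every curve over `ℚ`; over a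
general `K` this is Merel's theorem, NOT in the tree) bounds the odd primes `p` dividing a torsion
order by `p ∈ {3, 5, 7}`, and for each fixed odd `p` the exceptional set is finite
(`finite_setOf_twistClass_exists_torsion_ne_zero`). Modulo `hMz`; nothing else assumed.
[cite: MazurRubin2010, Lemma 5.5 and its proof (§5; manuscript p0017 L67–68, p0018 L3–8: "By Merel's Uniform Boundedness Theorem … the set {primes p : E^F(K)[p] ≠ 0 for some quadratic extension F/K} is finite")]
[cite: Mazur1977, Thm. (7') (p. 35)] -/
theorem finite_setOf_twistClass_exists_odd_torsion_rat
    (hMz : ∀ V : WeierstrassCurve ℚ, Mazur1977_addOrderOf_le V) (W : WeierstrassCurve ℚ)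
    [W.IsElliptic] :
    {t : SquareClass ℚ | ∃ s : ℚˣ, (QuotientGroup.mk s : SquareClass ℚ) = t ∧
        ∃ Q : (W.quadraticTwist (s : ℚ)).toAffine.Point,
          IsOfFinAddOrder Q ∧ Odd (addOrderOf Q) ∧ Q ≠ 0}.Finite := by
  -- the exceptional sets at the fixed odd primes `3, 5, 7` are finite (§4)
  refine (((finite_setOf_twistClass_exists_torsion_ne_zero W (by decide : Odd 3)).union
    (finite_setOf_twistClass_exists_torsion_ne_zero W (by decide : Odd 5))).union
    (finite_setOf_twistClass_exists_torsion_ne_zero W (by decide : Odd 7))).subset ?_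
  rintro t ⟨s, hst, Q, hQfin, hQodd, hQ0⟩
  haveI : (W.quadraticTwist (s : ℚ)).IsElliptic := W.isElliptic_quadraticTwist s.ne_zero
  -- `ord Q` is odd, `> 1`, and `≤ 10` or `= 12` (Mazur): its least prime factor is `3`, `5` or `7`
  have hnpos : 0 < addOrderOf Q := hQfin.addOrderOf_pos
  have hn1 : addOrderOf Q ≠ 1 := fun h1 ↦ hQ0 (AddMonoid.addOrderOf_eq_one_iff.mp h1)
  have hMaz : addOrderOf Q ≤ 10 ∨ addOrderOf Q = 12 := hMz (W.quadraticTwist (s : ℚ)) Q hQfin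
  have hn10 : addOrderOf Q ≤ 10 := by
    rcases hMaz with h | h
    · exact h
    · exfalso
      rw [h] at hQodd
      exact (by decide : ¬ Odd 12) hQodd
  obtain ⟨p, hp, hpn, hple⟩ : ∃ p : ℕ, p.Prime ∧ p ∣ addOrderOf Q ∧ p ≤ addOrderOf Q :=
    ⟨(addOrderOf Q).minFac, Nat.minFac_prime hn1, Nat.minFac_dvd _, Nat.minFac_le hnpos⟩
  have hp2 : p ≠ 2 := by
    rintro rfl
    exact hQodd.not_two_dvd_nat hpn
  have hp10 : p ≤ 10 := hple.trans hn10
  -- the point `(ord Q / p) • Q` is a non-zero point killed by `p`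
  have hpQ' : p • ((addOrderOf Q / p) • Q) = 0 := by
    rw [← mul_nsmul', Nat.mul_div_cancel' hpn]
    exact addOrderOf_nsmul_eq_zero Q
  have hQ'0 : (addOrderOf Q / p) • Q ≠ 0 := by
    intro h0
    have hdvd : addOrderOf Q ∣ addOrderOf Q / p := addOrderOf_dvd_iff_nsmul_eq_zero.mpr h0
    have hlt : addOrderOf Q / p < addOrderOf Q := Nat.div_lt_self hnpos hp.one_lt
    exact absurd (Nat.le_of_dvd (Nat.div_pos hple hp.pos) hdvd) (not_le.mpr hlt)
  -- `p ∈ {3, 5, 7}`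
  have hp357 : p = 3 ∨ p = 5 ∨ p = 7 := by
    interval_cases p <;> first | omega | (exfalso; revert hp; norm_num)
  -- (`convert` bridges the decidable-equality instance on `E(ℚ)` used by the general-`K` §4)
  rcases hp357 with rfl | rfl | rfl
  · exact Or.inl (Or.inl ⟨s, hst, (addOrderOf Q / 3) • Q, by convert hpQ', by convert hQ'0⟩)
  · exact Or.inl (Or.inr ⟨s, hst, (addOrderOf Q / 5) • Q, by convert hpQ', by convert hQ'0⟩)
  · exact Or.inr ⟨s, hst, (addOrderOf Q / 7) • Q, by convert hpQ', by convert hQ'0⟩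

/-- The same read through the tree's per-curve fact `mazur_torsion` (Mazur 1977 Thm. 8, structure
form; `Mazur1977_addOrderOf_le_of_mazur_torsion`). [cite: MazurRubin2010, Lemma 5.5 (§5)]
[cite: Mazur1977, Thm. (8)] -/
theorem finite_setOf_twistClass_exists_odd_torsion_rat_of_mazur_torsion
    (hMT : ∀ V : WeierstrassCurve ℚ, mazur_torsion V) (W : WeierstrassCurve ℚ) [W.IsElliptic] :
    {t : SquareClass ℚ | ∃ s : ℚˣ, (QuotientGroup.mk s : SquareClass ℚ) = t ∧
        ∃ Q : (W.quadraticTwist (s : ℚ)).toAffine.Point,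
          IsOfFinAddOrder Q ∧ Odd (addOrderOf Q) ∧ Q ≠ 0}.Finite :=
  finite_setOf_twistClass_exists_odd_torsion_rat
    (fun V ↦ Mazur1977_addOrderOf_le_of_mazur_torsion V (hMT V)) W

end Rat

/-! ## §6 The printed bound: at most TWO exceptional square classes for an odd prime `p`
("there are at most two characters `χ` of `G_K` such that `ρ_p ⊗ χ` contains a copy of the trivial
representation") -/

section EigenLines

variable {A : Type*} [AddCommGroup A] {p : ℕ} [hp : Fact p.Prime]

/-- An odd prime dividing `2 m` divides `m`. [folklore] -/
private theorem int_dvd_of_dvd_two_mul (hp2 : p ≠ 2) {m : ℤ} (h : (p : ℤ) ∣ 2 * m) : (p : ℤ) ∣ m := by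
  have hpr : Prime (p : ℤ) := Nat.prime_iff_prime_int.mp hp.out
  rcases hpr.dvd_or_dvd h with h2 | hm
  · exfalso
    have h2' : p ∣ 2 := by exact_mod_cast h2
    have := (Nat.prime_dvd_prime_iff_eq hp.out Nat.prime_two).mp h2'
    exact hp2 this
  · exact hm

/-- **Eigenvectors of an additive operator for the two different signs are independent over
`𝔽_p`** (`p` an odd prime): if `f P₁ = ε₁ P₁`, `f P₂ = ε₂ P₂` with `{ε₁, ε₂} = {1, −1}`, `P_i ≠ 0`,
`p P_i = 0`, then `m P₁ + n P₂ = 0` forces `p ∣ m` and `p ∣ n` (apply `f` and combine: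
`2m P₁ = 0 = 2n P₂`, and `ord P_i = p` is odd). The linear-algebra content of the printed "at most two
characters". [cite: MazurRubin2010, Lemma 5.5 (proof, §5: "at most two characters χ of G_K")] -/
theorem dvd_and_dvd_of_sign_separated (hp2 : p ≠ 2) {P₁ P₂ : A} (h₁0 : P₁ ≠ 0) (h₁p : p • P₁ = 0)
    (h₂0 : P₂ ≠ 0) (h₂p : p • P₂ = 0) (f : A →+ A)
    (hf : (f P₁ = P₁ ∧ f P₂ = -P₂) ∨ (f P₁ = -P₁ ∧ f P₂ = P₂)) {m n : ℤ}
    (h : m • P₁ + n • P₂ = 0) : (p : ℤ) ∣ m ∧ (p : ℤ) ∣ n := by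
  have ho₁ : addOrderOf P₁ = p := addOrderOf_eq_prime h₁p h₁0
  have ho₂ : addOrderOf P₂ = p := addOrderOf_eq_prime h₂p h₂0
  have hf0 : m • f P₁ + n • f P₂ = 0 := by
    have := congrArg f h
    rwa [map_add, map_zsmul, map_zsmul, map_zero] at this
  -- in both cases `2m • P₁ = 0` and `2n • P₂ = 0`
  have h2 : (2 * m) • P₁ = 0 ∧ (2 * n) • P₂ = 0 := by
    rcases hf with ⟨e₁, e₂⟩ | ⟨e₁, e₂⟩
    · rw [e₁, e₂, smul_neg] at hf0
      constructor
      · -- `(mP₁ + nP₂) + (mP₁ - nP₂) = 2mP₁`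
        have := congrArg₂ (· + ·) h hf0
        simp only [add_zero] at this
        rw [← this, mul_smul, two_smul]; abel
      · have := congrArg₂ (· - ·) h hf0
        simp only [sub_zero] at this
        rw [← this, mul_smul, two_smul]; abel
    · rw [e₁, e₂, smul_neg] at hf0
      constructor
      · have := congrArg₂ (· - ·) h hf0
        simp only [sub_zero] at this
        rw [← this, mul_smul, two_smul]; abel
      · have := congrArg₂ (· + ·) h hf0
        simp only [add_zero] at this
        rw [← this, mul_smul, two_smul]; abel
  refine ⟨int_dvd_of_dvd_two_mul hp2 ?_, int_dvd_of_dvd_two_mul hp2 ?_⟩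
  · have := (addOrderOf_dvd_iff_zsmul_eq_zero (x := P₁)).mpr h2.1
    rwa [ho₁] at this
  · have := (addOrderOf_dvd_iff_zsmul_eq_zero (x := P₂)).mpr h2.2
    rwa [ho₂] at this

omit hp in
/-- **A third eigenvector**: if `P₃ = a P₁ + b P₂` and an additive `f` acts on `P₁, P₂, P₃` by signs
`ε₁, ε₂, ε₃ ∈ {±1}` with `ε₁ ≠ ε₃`, then — granted the independence of `P₁, P₂` — `p ∣ a`.
[cite: MazurRubin2010, Lemma 5.5 (proof, §5)] -/
theorem dvd_of_third_sign {P₁ P₂ P₃ : A} (f : A →+ A) {ε₁ ε₂ ε₃ : ℤ}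
    (hε₁ : ε₁ = 1 ∨ ε₁ = -1) (hε₃ : ε₃ = 1 ∨ ε₃ = -1) (hne : ε₁ ≠ ε₃)
    (hf₁ : f P₁ = ε₁ • P₁) (hf₂ : f P₂ = ε₂ • P₂) (hf₃ : f P₃ = ε₃ • P₃) {a b : ℤ}
    (hab : P₃ = a • P₁ + b • P₂)
    (hind : ∀ m n : ℤ, m • P₁ + n • P₂ = 0 → (p : ℤ) ∣ m ∧ (p : ℤ) ∣ n) (hp2 : p ≠ 2)
    [Fact p.Prime] : (p : ℤ) ∣ a := by
  -- `a(ε₁ - ε₃) P₁ + b(ε₂ - ε₃) P₂ = 0`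
  have key : (a * (ε₁ - ε₃)) • P₁ + (b * (ε₂ - ε₃)) • P₂ = 0 := by
    have h1 : f P₃ = (a * ε₁) • P₁ + (b * ε₂) • P₂ := by
      rw [hab, map_add, map_zsmul, map_zsmul, hf₁, hf₂, smul_smul, smul_smul]
    have h2 : f P₃ = (a * ε₃) • P₁ + (b * ε₃) • P₂ := by
      rw [hf₃, hab, smul_add, smul_smul, smul_smul, mul_comm ε₃ a, mul_comm ε₃ b]
    have h3 := congrArg₂ (· - ·) h1 h2
    simp only [sub_self] at h3
    rw [mul_sub, mul_sub, sub_smul, sub_smul, ← h3.symm]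
    abel
  have hdvd := (hind _ _ key).1
  -- `ε₁ - ε₃ = ±2`
  have h2 : ε₁ - ε₃ = 2 ∨ ε₁ - ε₃ = -2 := by
    rcases hε₁ with rfl | rfl <;> rcases hε₃ with rfl | rfl <;> omega
  rcases h2 with h2 | h2
  · rw [h2, mul_comm] at hdvd
    exact int_dvd_of_dvd_two_mul hp2 hdvd
  · rw [h2, mul_comm] at hdvd
    have : (p : ℤ) ∣ 2 * a := by
      have := hdvd
      rw [show (-2 : ℤ) * a = -(2 * a) by ring, dvd_neg] at this
      exact this
    exact int_dvd_of_dvd_two_mul hp2 this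

omit hp in
/-- **Two independent elements span a group of order `p²`**: in a finite abelian group `T` with
`#T = p²`, if `m P₁ + n P₂ = 0 ⟹ p ∣ m, n`, then every element is `a P₁ + b P₂` (the `p²` combinations
with `0 ≤ a, b < p` are distinct, hence exhaust `T`). [cite: SilvermanAEC2009, Cor. III.6.4 (E[m] ≅ ℤ/m × ℤ/m)] -/
theorem exists_eq_zsmul_add_zsmul_of_card_eq_sq {T : Type*} [AddCommGroup T] [Finite T]
    (hcard : Nat.card T = p ^ 2) {P₁ P₂ : T}
    (hind : ∀ m n : ℤ, m • P₁ + n • P₂ = 0 → (p : ℤ) ∣ m ∧ (p : ℤ) ∣ n) (x : T) :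
    ∃ a b : ℤ, x = a • P₁ + b • P₂ := by
  set φ : Fin p × Fin p → T := fun ab ↦ ((ab.1 : ℕ) : ℤ) • P₁ + ((ab.2 : ℕ) : ℤ) • P₂ with hφ
  have hinj : Function.Injective φ := by
    rintro ⟨a, b⟩ ⟨a', b'⟩ heq
    simp only [hφ] at heq
    have key : (((a : ℕ) : ℤ) - ((a' : ℕ) : ℤ)) • P₁ + (((b : ℕ) : ℤ) - ((b' : ℕ) : ℤ)) • P₂ = 0 := by
      rw [sub_smul, sub_smul, ← sub_eq_zero.mpr heq]
      abel
    obtain ⟨ha, hb⟩ := hind _ _ key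
    have ha' : ((a : ℕ) : ℤ) = ((a' : ℕ) : ℤ) := by
      have h1 : (((a : ℕ) : ℤ) - ((a' : ℕ) : ℤ)).natAbs < p := by
        have := a.2; have := a'.2; omega
      have := Int.eq_zero_of_dvd_of_natAbs_lt_natAbs ha (by simpa using h1)
      omega
    have hb' : ((b : ℕ) : ℤ) = ((b' : ℕ) : ℤ) := by
      have h1 : (((b : ℕ) : ℤ) - ((b' : ℕ) : ℤ)).natAbs < p := by
        have := b.2; have := b'.2; omega
      have := Int.eq_zero_of_dvd_of_natAbs_lt_natAbs hb (by simpa using h1)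
      omega
    ext <;> simp_all
  have hbij : Function.Bijective φ :=
    hinj.bijective_of_nat_card_le (by rw [hcard, Nat.card_prod, Nat.card_fin, sq])
  obtain ⟨⟨a, b⟩, hab⟩ := hbij.2 x
  exact ⟨((a : ℕ) : ℤ), ((b : ℕ) : ℤ), hab.symm⟩

end EigenLines

section AtMostTwo

variable {K : Type u} [Field K] [NumberField K]

omit [NumberField K] in
/-- **Signs**: a `χ_s`-eigenvector `P` (`σP = ±P` according to `σ√s = ±√s`) has, for each `σ`, an
integer sign `ε ∈ {±1}` with `σP = εP`. [cite: MazurRubin2010, Lemma 5.5 (proof, §5)] -/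
private theorem exists_sign_smul_eq (W : WeierstrassCurve K) {s : K} {P : W.geomPoints}
    (h : ∀ σ : absoluteGaloisGroup K,
      (σ • geomSqrt s = geomSqrt s → σ • P = P) ∧ (σ • geomSqrt s = -geomSqrt s → σ • P = -P))
    (σ : absoluteGaloisGroup K) : ∃ ε : ℤ, (ε = 1 ∨ ε = -1) ∧ σ • P = ε • P := by
  rcases smul_geomSqrt_eq_or σ s with hσ | hσ
  · exact ⟨1, Or.inl rfl, by rw [(h σ).1 hσ, one_smul]⟩
  · exact ⟨-1, Or.inr rfl, by rw [(h σ).2 hσ, neg_one_zsmul]⟩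

/-- **Different square classes give different signs somewhere**: if `[s₁] ≠ [s₂]` then some
`σ ∈ Γ_K` fixes exactly one of `√s₁, √s₂`, so acts on the eigenvectors by opposite signs.
[cite: MazurRubin2010, Lemma 5.5 (proof, §5)] -/
private theorem exists_smul_opposite (W : WeierstrassCurve K) {s₁ s₂ : Kˣ}
    (hne : (QuotientGroup.mk s₁ : SquareClass K) ≠ QuotientGroup.mk s₂) {P₁ P₂ : W.geomPoints}
    (h₁ : ∀ σ : absoluteGaloisGroup K, (σ • geomSqrt (s₁ : K) = geomSqrt (s₁ : K) → σ • P₁ = P₁) ∧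
      (σ • geomSqrt (s₁ : K) = -geomSqrt (s₁ : K) → σ • P₁ = -P₁))
    (h₂ : ∀ σ : absoluteGaloisGroup K, (σ • geomSqrt (s₂ : K) = geomSqrt (s₂ : K) → σ • P₂ = P₂) ∧
      (σ • geomSqrt (s₂ : K) = -geomSqrt (s₂ : K) → σ • P₂ = -P₂)) :
    ∃ σ : absoluteGaloisGroup K, (σ • P₁ = P₁ ∧ σ • P₂ = -P₂) ∨ (σ • P₁ = -P₁ ∧ σ • P₂ = P₂) := by
  by_contra hcon
  push Not at hcon
  apply hne
  rw [← squareClassOf_units, ← squareClassOf_units]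
  refine squareClassOf_eq_of_forall_smul_geomSqrt_iff s₁.ne_zero s₂.ne_zero fun σ ↦ ⟨?_, ?_⟩
  · intro e₁
    rcases smul_geomSqrt_eq_or σ (s₂ : K) with e₂ | e₂
    · exact e₂
    · exact absurd ((h₂ σ).2 e₂) ((hcon σ).1 ((h₁ σ).1 e₁))
  · intro e₂
    rcases smul_geomSqrt_eq_or σ (s₁ : K) with e₁ | e₁
    · exact e₁
    · exact absurd ((h₂ σ).1 e₂) ((hcon σ).2 ((h₁ σ).2 e₁))

/-- **Mazur–Rubin 2010, Lemma 5.5, the printed bound (proved): for a fixed odd prime `p`, at most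
TWO square classes `t ∈ K^×/(K^×)²` have a twist `W^{(s)}`, `[s] = t`, with a non-zero `K`-rational
point killed by `p`** ("there are at most two characters `χ` of `G_K` such that `ρ_p ⊗ χ` contains a
copy of the trivial representation. Therefore for fixed odd `p`, the set `{F/K quadratic :
E^F(K)[p] ≠ 0}` has order at most `2`"; here the trivial class — `E(K)[p] ≠ 0` itself — is counted
among the two, as in the character count). Proof: three classes would give three non-zero points
`P₁, P₂, P₃ ∈ E[p](K̄)` on which `Γ_K` acts through three distinct quadratic characters; `P₁, P₂` are
`𝔽_p`-independent (`dvd_and_dvd_of_sign_separated`), hence span `E[p] ≅ (ℤ/p)²`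
(`card_torsionPoints_eq_sq_holds`, `exists_eq_zsmul_add_zsmul_of_card_eq_sq`), and `P₃ = aP₁ + bP₂`
with `p ∣ a, b` (`dvd_of_third_sign`), i.e. `P₃ = 0`.
[cite: MazurRubin2010, Lemma 5.5 and its proof (§5; manuscript p0018 L9–13)]
[cite: SilvermanAEC2009, Cor. III.6.4] -/
theorem ncard_setOf_twistClass_exists_torsion_ne_zero_le_two (W : WeierstrassCurve K) [W.IsElliptic]
    {p : ℕ} [hp : Fact p.Prime] (hp2 : p ≠ 2) :
    {t : SquareClass K | ∃ s : Kˣ, (QuotientGroup.mk s : SquareClass K) = t ∧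
        ∃ Q : (W.quadraticTwist (s : K)).toAffine.Point, p • Q = 0 ∧ Q ≠ 0}.ncard ≤ 2 := by
  have hfin := finite_setOf_twistClass_exists_torsion_ne_zero W (hp.out.odd_of_ne_two hp2)
  by_contra hlt
  rw [not_le, Set.two_lt_ncard_iff hfin] at hlt
  obtain ⟨t₁, t₂, t₃, ⟨s₁, hs₁, Q₁, hpQ₁, hQ₁⟩, ⟨s₂, hs₂, Q₂, hpQ₂, hQ₂⟩, ⟨s₃, hs₃, Q₃, hpQ₃, hQ₃⟩,
    h12, h13, h23⟩ := hlt
  obtain ⟨P₁, hP₁0, hpP₁, hP₁⟩ := exists_geomPoint_sign_of_torsion_quadraticTwist W s₁.ne_zero hpQ₁ hQ₁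
  obtain ⟨P₂, hP₂0, hpP₂, hP₂⟩ := exists_geomPoint_sign_of_torsion_quadraticTwist W s₂.ne_zero hpQ₂ hQ₂
  obtain ⟨P₃, hP₃0, hpP₃, hP₃⟩ := exists_geomPoint_sign_of_torsion_quadraticTwist W s₃.ne_zero hpQ₃ hQ₃
  rw [← hs₁, ← hs₂] at h12
  rw [← hs₁, ← hs₃] at h13
  rw [← hs₂, ← hs₃] at h23
  -- the action of `σ` as an additive endomorphism
  let F : absoluteGaloisGroup K → (W.geomPoints →+ W.geomPoints) := fun σ ↦
    DistribSMul.toAddMonoidHom W.geomPoints σ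
  have hF : ∀ σ (P : W.geomPoints), F σ P = σ • P := fun σ P ↦ rfl
  -- independence of `P₁, P₂` (and of `P₂, P₁`)
  obtain ⟨σ₁₂, hσ₁₂⟩ := exists_smul_opposite W h12 hP₁ hP₂
  have hind : ∀ m n : ℤ, m • P₁ + n • P₂ = 0 → (p : ℤ) ∣ m ∧ (p : ℤ) ∣ n := fun m n h ↦
    dvd_and_dvd_of_sign_separated hp2 hP₁0 hpP₁ hP₂0 hpP₂ (F σ₁₂)
      (by simpa only [hF] using hσ₁₂) h
  have hind' : ∀ m n : ℤ, m • P₂ + n • P₁ = 0 → (p : ℤ) ∣ m ∧ (p : ℤ) ∣ n := fun m n h ↦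
    ((hind n m (by rw [add_comm]; exact h)).symm)
  -- `P₃ = a P₁ + b P₂` inside `E[p](K̄)`, a group of order `p²`
  have hp0 : (p : ℤ) ≠ 0 := by exact_mod_cast hp.out.ne_zero
  haveI : Finite (geomTorsion W (p : ℤ)) := finite_torsionPoints_holds W (AlgebraicClosure K) hp0
  have hcard : Nat.card (geomTorsion W (p : ℤ)) = p ^ 2 :=
    card_torsionPoints_eq_sq_holds W (AlgebraicClosure K)
      (by exact_mod_cast (hp.out.ne_zero : p ≠ 0) :
        ((p : ℕ) : AlgebraicClosure K) ≠ 0)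
  have mem : ∀ {P : W.geomPoints}, p • P = 0 → P ∈ geomTorsion W (p : ℤ) := fun h ↦
    AddSubgroup.torsionBy.nsmul_iff.mpr h
  have hindT : ∀ m n : ℤ, m • (⟨P₁, mem hpP₁⟩ : geomTorsion W (p : ℤ)) +
      n • (⟨P₂, mem hpP₂⟩ : geomTorsion W (p : ℤ)) = 0 → (p : ℤ) ∣ m ∧ (p : ℤ) ∣ n := by
    intro m n h
    apply hind m n
    have := congrArg (Subtype.val) h
    simpa using this
  obtain ⟨a, b, habT⟩ := exists_eq_zsmul_add_zsmul_of_card_eq_sq hcard hindT ⟨P₃, mem hpP₃⟩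
  have hab : P₃ = a • P₁ + b • P₂ := by
    have := congrArg (Subtype.val) habT
    simpa using this
  -- `p ∣ a` from a `σ` separating the classes of `s₁` and `s₃`
  have hdvd_a : (p : ℤ) ∣ a := by
    obtain ⟨σ, hσ⟩ := exists_smul_opposite W h13 hP₁ hP₃
    obtain ⟨ε₂, hε₂, hσ₂⟩ := exists_sign_smul_eq W hP₂ σ
    rcases hσ with ⟨e₁, e₃⟩ | ⟨e₁, e₃⟩
    · exact dvd_of_third_sign (F σ) (ε₁ := 1) (ε₃ := -1) (Or.inl rfl) (Or.inr rfl) (by norm_num)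
        (by rw [hF, e₁, one_smul]) (by rw [hF, hσ₂]) (by rw [hF, e₃, neg_one_zsmul]) hab hind hp2
    · exact dvd_of_third_sign (F σ) (ε₁ := -1) (ε₃ := 1) (Or.inr rfl) (Or.inl rfl) (by norm_num)
        (by rw [hF, e₁, neg_one_zsmul]) (by rw [hF, hσ₂]) (by rw [hF, e₃, one_smul]) hab hind hp2
  -- `p ∣ b` from a `σ` separating the classes of `s₂` and `s₃`
  have hdvd_b : (p : ℤ) ∣ b := by
    obtain ⟨σ, hσ⟩ := exists_smul_opposite W h23 hP₂ hP₃
    obtain ⟨ε₁, hε₁, hσ₁⟩ := exists_sign_smul_eq W hP₁ σ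
    have hab' : P₃ = b • P₂ + a • P₁ := by rw [hab, add_comm]
    rcases hσ with ⟨e₂, e₃⟩ | ⟨e₂, e₃⟩
    · exact dvd_of_third_sign (F σ) (ε₁ := 1) (ε₃ := -1) (Or.inl rfl) (Or.inr rfl) (by norm_num)
        (by rw [hF, e₂, one_smul]) (by rw [hF, hσ₁]) (by rw [hF, e₃, neg_one_zsmul]) hab' hind' hp2
    · exact dvd_of_third_sign (F σ) (ε₁ := -1) (ε₃ := 1) (Or.inr rfl) (Or.inl rfl) (by norm_num)
        (by rw [hF, e₂, neg_one_zsmul]) (by rw [hF, hσ₁]) (by rw [hF, e₃, one_smul]) hab' hind' hp2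
  -- hence `P₃ = 0`
  apply hP₃0
  have ha0 : a • P₁ = 0 := by
    rw [← addOrderOf_dvd_iff_zsmul_eq_zero, addOrderOf_eq_prime hpP₁ hP₁0]
    exact hdvd_a
  have hb0 : b • P₂ = 0 := by
    rw [← addOrderOf_dvd_iff_zsmul_eq_zero, addOrderOf_eq_prime hpP₂ hP₂0]
    exact hdvd_b
  rw [hab, ha0, hb0, add_zero]

end AtMostTwo

/-! ## §7 The prime `2`: rational `2`-torsion is the same throughout a twist family -/

section Two

variable {K : Type u} [Field K] [NumberField K]

/-- **At `p = 2` there are NO exceptional classes when `E(K)[2] = 0`**: a non-zero `K`-rational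
`2`-torsion point `Q` of ANY twist `W^{(s)}` gives a non-zero point of `W(K)[2]` — its image
`P = f(Q) ∈ E[2](K̄)` (`exists_geomPoint_sign_of_torsion_quadraticTwist`) satisfies `σP = ±P = P`
(`2P = 0`), so `P` is `Γ_K`-fixed, hence `K`-rational (Galois descent,
`exists_toGeomPoints_eq_of_forall_smul_eq`). (Why the printed lemma says "`p` odd": the twists
`E′` of `E` share their rational `2`-torsion.) [cite: MazurRubin2010, Lemma 5.5 (proof, §5: "if p is odd")]
[cite: SilvermanAEC2009, X.5 Cor. 5.4 and VIII.§1] -/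
theorem exists_two_torsion_ne_zero_of_quadraticTwist (W : WeierstrassCurve K) {s : K} (hs : s ≠ 0)
    {Q : (W.quadraticTwist s).toAffine.Point} (h2Q : 2 • Q = 0) (hQ0 : Q ≠ 0) :
    ∃ R : W.toAffine.Point, 2 • R = 0 ∧ R ≠ 0 := by
  obtain ⟨P, hP0, h2P, hP⟩ := exists_geomPoint_sign_of_torsion_quadraticTwist W hs h2Q hQ0
  -- `-P = P`, so `P` is `Γ_K`-fixed
  have hneg : -P = P := by
    rw [neg_eq_iff_add_eq_zero, ← two_nsmul, h2P]
  have hfix : ∀ σ : absoluteGaloisGroup K, σ • P = P := by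
    intro σ
    rcases smul_geomSqrt_eq_or σ s with hσ | hσ
    · exact (hP σ).1 hσ
    · rw [(hP σ).2 hσ, hneg]
  obtain ⟨R, hR⟩ := exists_toGeomPoints_eq_of_forall_smul_eq W hfix
  refine ⟨R, ?_, ?_⟩
  · apply toGeomPoints_injective W
    rw [map_nsmul, hR, h2P, map_zero]
  · intro h0
    rw [h0, map_zero] at hR
    exact hP0 hR.symm

/-- **`E(K)[2] = 0 ⟹ E^{(s)}(K)[2] = 0` for every `s ∈ K^×`** (counting form: `#W(K)[2] = 1 ⟹
#W^{(s)}(K)[2] = 1`). [cite: MazurRubin2010, Lemma 5.5 (proof, §5)] [cite: SilvermanAEC2009, X.5 Cor. 5.4] -/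
theorem natCard_two_torsionBy_quadraticTwist_eq_one (W : WeierstrassCurve K)
    (hW : Nat.card (AddSubgroup.torsionBy W.toAffine.Point (2 : ℤ)) = 1) {s : K} (hs : s ≠ 0) :
    Nat.card (AddSubgroup.torsionBy (W.quadraticTwist s).toAffine.Point (2 : ℤ)) = 1 := by
  rw [Nat.card_eq_one_iff_unique]
  refine ⟨⟨fun x y ↦ ?_⟩, ⟨0⟩⟩
  have hz : ∀ z : AddSubgroup.torsionBy (W.quadraticTwist s).toAffine.Point (2 : ℤ), z = 0 := by
    intro z
    by_contra hz
    obtain ⟨R, h2R, hR0⟩ := exists_two_torsion_ne_zero_of_quadraticTwist W hs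
      (AddSubgroup.torsionBy.nsmul_iff.mp z.2 : (2 : ℕ) • (z : (W.quadraticTwist s).toAffine.Point) = 0)
      (fun h0 ↦ hz (Subtype.ext h0))
    -- `R` is a second element of the one-element type `W(K)[2]`
    have hR : (⟨R, AddSubgroup.torsionBy.nsmul_iff.mpr h2R⟩ :
        AddSubgroup.torsionBy W.toAffine.Point (2 : ℤ)) = 0 := by
      haveI := (Nat.card_eq_one_iff_unique.mp hW).1
      exact Subsingleton.elim _ _
    exact hR0 (congrArg Subtype.val hR)
  rw [hz x, hz y]

end Two

end Literature.NumberTheory.EllipticCurves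

end
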